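import Summits.NavierStokesRegularity.NavierStokesRegularity.Theorems.CorkscrewDynamoCorkscrewProfileRdssTunedCompactness
import Summits.NavierStokesRegularity.NavierStokesRegularity.Theorems.CorkscrewDynamoCorkscrewProfileAngleTuning
import Summits.NavierStokesRegularity.NavierStokesRegularity.Theorems.CorkscrewDynamoCorkscrewProfileNormalForm
import Summits.NavierStokesRegularity.NavierStokesRegularity.Theorems.RellichScarSymmetricScarExistsApexClassicalRepresentative
import Literature.Analysis.FluidPDE.ChaeWolfRemovingDSSProofs
import HarnessLib

/-!
# Route CorkscrewDynamo · crux `CorkscrewProfile` (stmt-NavierStokesRegularity-11282) — NEAR-IDENTITY RIGIDITY of the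
# corkscrew witness set (lead c4, line `registered`, tool stub F5: the assembly)

**Theorem (`exists_rss_of_nearIdentity`, Oseen gauge).** Fix a Type-I constant `C₀ > 0`. Let `V_n` be NONTRIVIAL
Oseen-gauge Type-I fields (`IsTypeIAncientMild C₀`, `HasTypeIDecay C₀`), each rotated `c_n`-DSS about `e₃` through
`rotZLIE θ_n` — ANY angles `θ_n` — with `1 < c_n → 1`. Then there are a rate `β ≠ 0` and a NONTRIVIAL Oseen-gauge Type-I
field `W` (`IsTypeIAncientMild C₀ W`, `HasTypeIDecay C₀ W`, `W = 0` on `t ≥ 0`, `W(−1) ≠ 0`) which is ROTATED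
SELF-SIMILAR: `IsRotatedDSS μ (rotZLIE (β log μ)) W` for EVERY `μ > 0`.

Proof: the angle tuning for arbitrary angles (`stub_angleTuning`: Dirichlet re-tuning, then the rate trichotomy) gives a
subsequence and a rate `β` such that every `μ ≥ 1` is a limit of powers `c^{k}` with accumulated angles `kθ → β log μ`
(mod `2π`); KNSS Lemma 6.1 compactness along these tuned exponents (`stub_rdssTunedCompactness`) gives a nontrivial
limit `W` which is rotated `μ`-DSS through `rotZLIE (β log μ)` for all `μ ≥ 1`; `β = 0` would make `W` plainly `μ`-DSS for
every `μ ≥ 1`, in particular for `μ` below Chae–Wolf's removal threshold `c₁(C₀)` (`chaeWolf2017_removing_dss_holds`,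
applied to `W` with its global classical pressure `exists_isClassicalNSSolutionOn_Iio_of_isTypeIAncientMild`) — so
`W ≡ 0` on the past, contradicting `W(−1) ≠ 0`; and the inverse pair (`IsRotatedDSS.rotZ_inv`) extends the law to
`0 < μ < 1`. The two branches of the trichotomy that end in a contradiction are exactly the tree's proof of Pineau–Vicol
2026 Thm 1.7 (`PineauVicol2026.false_of_rdss_sequence`); the new branch is the finite nonzero rate.

**Consequences for the crux.**
* `rssProfileExists_of_nearIdentity_rdss` — from duality-form data (`IsAncientMildSolution`, measurable slices, through
  the sharp representative `stub_sharpRepresentative`): near-identity nontrivial Type-I rotated-DSS ancient mild solutions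
  about `e₃` at a bounded constant give `FilamentSkeletonRss.RssProfileExists` (stmt-16274, the open stub of the line) —
  hence `corkscrewProfile_of_nearIdentity_rdss` / `corkscrewProfile_of_nearIdentity_pinned` (the crux).
* `nearIdentity_rdss_removal_of_not_rssProfileExists` / `…_of_not_corkscrewProfile` — contrapositive: if there is no
  RSS profile (a fortiori if there is no corkscrew), then for every `C₀` there is `c₁ > 1` such that EVERY Type-I (`C₀`)
  rotated-DSS ancient mild solution about `e₃` with factor `c ∈ (1, c₁)` vanishes — Chae–Wolf 2017 Thm 1.3 (stated and
  proved for PLAIN `λ`-DSS only, arXiv:1610.09464 p. 3) upgraded to all rotated DSS about a fixed axis. So the factors of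
  corkscrews at level `C₀` are bounded away from `1` unless the sibling target holds.
* `rdss_removal_commensurable` (unconditional): for commensurable angles `qθ ∈ 2πℤ` a rotated `c`-DSS field is plainly
  `c^q`-DSS, so Chae–Wolf removes it for `c^q < c₁(C₀)`; `quarterTurn_nearIdentityRemoval` is the literal statement of
  `QuarterTurnRdss.NearIdentityRemoval` (stmt-1102, `q = 4`).
* `stub_nearIdentityRigidity` — the registered signature.
-/

noncomputable section

open Set Function MeasureTheory Filter Topology Metric Literature.Analysis.FluidPDE

namespace Summit.NavierStokesRegularity.NavierStokesRegularity.Theorems.CorkscrewProfile.Birth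

set_option linter.dupNamespace false

/-! ### The core: near-identity rotated DSS forces rotated self-similarity (Oseen gauge) -/

/-- **Near-identity rotated DSS at a bounded constant forces a rotated self-similar field** (Oseen gauge; see the module
docstring). [cite: ChaeWolf2017RemovingDSS, Thm 1.3 and §3 (arXiv:1610.09464 pp. 3, 8–9);
KochNadirashviliSereginSverak2009, Lemma 6.1] -/
theorem exists_rss_of_nearIdentity {C₀ : ℝ} {c θ : ℕ → ℝ}
    {V : ℕ → ℝ → EuclideanSpace ℝ (Fin 3) → EuclideanSpace ℝ (Fin 3)} (hC₀ : 0 < C₀) (hc1 : ∀ n, 1 < c n)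
    (hclim : Tendsto c atTop (𝓝 1)) (hV : ∀ n, IsTypeIAncientMild C₀ (V n)) (hdec : ∀ n, HasTypeIDecay C₀ (V n))
    (hrdss : ∀ n, IsRotatedDSS (c n) (rotZLIE (θ n)) (V n)) (hnt : ∀ n, ∃ t < 0, ∃ x, V n t x ≠ 0) :
    ∃ (β : ℝ) (W : ℝ → EuclideanSpace ℝ (Fin 3) → EuclideanSpace ℝ (Fin 3)), β ≠ 0 ∧ IsTypeIAncientMild C₀ W ∧
      HasTypeIDecay C₀ W ∧ (∀ t, 0 ≤ t → W t = 0) ∧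
      (∀ μ : ℝ, 0 < μ → IsRotatedDSS μ (rotZLIE (β * Real.log μ)) W) ∧ ∃ x, W (-1) x ≠ 0 := by
  -- pass to a tail with `c n ≤ 2`
  obtain ⟨N, hN⟩ := eventually_atTop.1 (hclim.eventually (Iic_mem_nhds (by norm_num : (1 : ℝ) < 2)))
  have hclim' : Tendsto (fun n => c (n + N)) atTop (𝓝 1) := (tendsto_add_atTop_iff_nat N).2 hclim
  -- angle tuning along a subsequence
  obtain ⟨φ, β, hφ, htune⟩ := stub_angleTuning (fun n => c (n + N)) (fun n => θ (n + N)) (fun n => hc1 _) hclim'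
  -- compactness along the tuned exponents
  obtain ⟨W, hW, hWdec, hW0, hWrss, x₀, hx₀⟩ :=
    stub_rdssTunedCompactness C₀ (fun n => c (φ n + N)) (fun n => θ (φ n + N)) (fun μ => β * Real.log μ)
      (fun n => V (φ n + N)) hC₀ (fun n => hc1 _) (fun n => hN _ (Nat.le_add_left _ _)) (hclim'.comp hφ.tendsto_atTop)
      (fun n => hV _) (fun n => hdec _) (fun n => hrdss _) (fun n => hnt _) htune
  -- `β = 0` is excluded by Chae–Wolf: the limit would be plainly `μ`-DSS for every `μ ≥ 1`
  have hβ : β ≠ 0 := by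
    intro hβ0
    obtain ⟨c₁, hc₁, hCW⟩ := chaeWolf2017_removing_dss_holds C₀ hC₀
    obtain ⟨q, hq⟩ :=
      Summit.NavierStokesRegularity.NavierStokesRegularity.Theorems.SymmetricScarExists.LogtimeBernoulli.exists_isClassicalNSSolutionOn_Iio_of_isTypeIAncientMild
        hW
    set μ : ℝ := (1 + c₁) / 2 with hμ
    have hμ1 : 1 < μ := by rw [hμ]; linarith
    have hμc : μ < c₁ := by rw [hμ]; linarith
    have hdss : IsDiscretelySelfSimilar μ W := by
      have h := hWrss μ hμ1.le
      rw [hβ0, zero_mul, rotZLIE_zero] at h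
      exact isRotatedDSS_refl_iff.1 h
    exact hx₀ (hCW μ hμ1 hμc W q hq hdss hWdec (-1) (by norm_num) x₀)
  refine ⟨β, W, hβ, hW, hWdec, hW0, fun μ hμ => ?_, x₀, hx₀⟩
  -- the law for all `μ > 0`: the inverse pair for `μ < 1`
  rcases le_or_gt 1 μ with hμ1 | hμ1
  · exact hWrss μ hμ1
  · have hinv : 1 ≤ μ⁻¹ := (one_le_inv₀ hμ).2 hμ1.le
    have h := IsRotatedDSS.rotZ_inv (inv_pos.2 hμ) (hWrss μ⁻¹ hinv)
    rwa [inv_inv, Real.log_inv, mul_neg, neg_neg] at h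

/-! ### From duality-form data to the sibling target `RssProfileExists` -/

/-- **Near-identity rotated-DSS ancient mild solutions give an RSS profile.** If for one Type-I constant `C₀` there are
NONTRIVIAL Type-I ancient mild solutions `u_n` (duality form, measurable slices), rotated `c_n`-DSS about `e₃` through
`rotZLIE θ_n` with `1 < c_n → 1`, then `FilamentSkeletonRss.RssProfileExists` holds: the rotated self-similar field `W` of
`exists_rss_of_nearIdentity` (run on the sharp representatives `stub_sharpRepresentative`), with speed `α = −β/2`,
profile `U = W(−1)` and `Rot = rotZLIE`. -/
theorem rssProfileExists_of_nearIdentity_rdss (C₀ : ℝ) (c θ : ℕ → ℝ)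
    (u : ℕ → ℝ → EuclideanSpace ℝ (Fin 3) → EuclideanSpace ℝ (Fin 3)) (hc1 : ∀ n, 1 < c n)
    (hclim : Tendsto c atTop (𝓝 1)) (hmild : ∀ n, IsAncientMildSolution 1 (u n))
    (hmeas : ∀ n, ∀ t < 0, AEStronglyMeasurable (u n t) volume)
    (hrdss : ∀ n, IsRotatedDSS (c n) (rotZLIE (θ n)) (u n)) (hTI : ∀ n, HasTypeIDecay C₀ (u n))
    (hnz : ∀ n, ¬ ∀ t < 0, u n t =ᵐ[volume] 0) :
    Summit.NavierStokesRegularity.NavierStokesRegularity.Theses.FilamentSkeletonRss.RssProfileExists := by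
  have hc0 : ∀ n, 0 < c n := fun n => one_pos.trans (hc1 n)
  -- the constant is positive
  have hC₀ : 0 < C₀ := by
    obtain ⟨ε, hε, h⟩ := corkscrew_constant_lower_bound
    exact hε.trans (h (c 0) (rotZLIE (θ 0)) (u 0) C₀ (hc0 0) (hmild 0) (hmeas 0) (hrdss 0) (hTI 0) (hnz 0))
  -- sharp representatives
  choose V hV hVdss hVdec hVu _hV0 using fun n =>
    stub_sharpRepresentative (c n) (rotZLIE (θ n)) (u n) C₀ (hc0 n) (hmild n) (hmeas n) (hrdss n) (hTI n)
  have hnt : ∀ n, ∃ t < 0, ∃ x, V n t x ≠ 0 := fun n => by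
    by_contra hcon
    push Not at hcon
    refine hnz n fun t ht => ?_
    have hVt : V n t = 0 := funext fun x => hcon t ht x
    rw [← hVt]
    exact (hVu n t ht).symm
  obtain ⟨β, W, hβ, hW, hWdec, -, hWrss, x₀, hx₀⟩ := exists_rss_of_nearIdentity hC₀ hc1 hclim hV hVdec hVdss hnt
  refine ⟨-β / 2, C₀, W (-1), rotZLIE, W, by simpa using hβ, fun ψ => stub_rdssIterate.2.2.2 ψ,
    contDiff_infty.1 (hW.contDiff_slice (by norm_num)) 2, fun h0 => hx₀ (by rw [h0]; rfl), rfl,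
    fun a ha => ?_, hW.isAncientMildSolution, fun t ht => hW.aestronglyMeasurable_slice ht, hWdec⟩
  have e : -(-β / 2 * (2 * Real.log a)) = β * Real.log a := by ring
  rw [e]
  exact hWrss a ha

/-- **Near-identity rotated-DSS ancient mild solutions about `e₃` at a bounded constant give the crux.** -/
theorem corkscrewProfile_of_nearIdentity_rdss (C₀ : ℝ) (c θ : ℕ → ℝ)
    (u : ℕ → ℝ → EuclideanSpace ℝ (Fin 3) → EuclideanSpace ℝ (Fin 3)) (hc1 : ∀ n, 1 < c n)
    (hclim : Tendsto c atTop (𝓝 1)) (hmild : ∀ n, IsAncientMildSolution 1 (u n))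
    (hmeas : ∀ n, ∀ t < 0, AEStronglyMeasurable (u n t) volume)
    (hrdss : ∀ n, IsRotatedDSS (c n) (rotZLIE (θ n)) (u n)) (hTI : ∀ n, HasTypeIDecay C₀ (u n))
    (hnz : ∀ n, ¬ ∀ t < 0, u n t =ᵐ[volume] 0) :
    Summit.NavierStokesRegularity.NavierStokesRegularity.Theses.CorkscrewDynamo.CorkscrewProfile :=
  corkscrewProfile_of_rssProfileExists
    (rssProfileExists_of_nearIdentity_rdss C₀ c θ u hc1 hclim hmild hmeas hrdss hTI hnz)

/-- **The crux in its own vocabulary: accumulation at the identity suffices.** If for one constant `C₀` and every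
`δ > 0` there is a NONTRIVIAL Type-I (`C₀`) ancient mild solution, rotated `c`-DSS about `e₃` through a coordinate-pinned
rotation, with `1 < c < 1 + δ` (NO essential-rotation clause, any angle), then `CorkscrewProfile` holds. -/
theorem corkscrewProfile_of_nearIdentity_pinned
    (h : ∃ C₀ : ℝ, ∀ δ : ℝ, 0 < δ → ∃ (c θ : ℝ) (R : EuclideanSpace ℝ (Fin 3) ≃ₗᵢ[ℝ] EuclideanSpace ℝ (Fin 3))
      (u : ℝ → EuclideanSpace ℝ (Fin 3) → EuclideanSpace ℝ (Fin 3)), 1 < c ∧ c < 1 + δ ∧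
      (∀ x : EuclideanSpace ℝ (Fin 3), R x 0 = Real.cos θ * x 0 - Real.sin θ * x 1 ∧
        R x 1 = Real.sin θ * x 0 + Real.cos θ * x 1 ∧ R x 2 = x 2) ∧
      IsAncientMildSolution 1 u ∧ (∀ t < 0, AEStronglyMeasurable (u t) volume) ∧ IsRotatedDSS c R u ∧
      HasTypeIDecay C₀ u ∧ ¬ ∀ t < 0, u t =ᵐ[volume] 0) :
    Summit.NavierStokesRegularity.NavierStokesRegularity.Theses.CorkscrewDynamo.CorkscrewProfile := by
  obtain ⟨C₀, h⟩ := h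
  have hpos : ∀ n : ℕ, (0 : ℝ) < 1 / ((n : ℝ) + 1) := fun n => by positivity
  choose c θ R u hc1 hc2 hR hmild hmeas hrdss hTI hnz using fun n : ℕ => h (1 / ((n : ℝ) + 1)) (hpos n)
  have hclim : Tendsto c atTop (𝓝 1) := by
    have h0 : Tendsto (fun n : ℕ => (1 : ℝ) + 1 / ((n : ℝ) + 1)) atTop (𝓝 (1 + 0)) :=
      tendsto_const_nhds.add tendsto_one_div_add_atTop_nhds_zero_nat
    rw [add_zero] at h0
    exact tendsto_of_tendsto_of_tendsto_of_le_of_le tendsto_const_nhds h0 (fun n => (hc1 n).le)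
      (fun n => (hc2 n).le)
  have hRθ : ∀ n, R n = rotZLIE (θ n) := fun n =>
    LinearIsometryEquiv.ext fun x => by rw [eq_rotZ_of_pinned (hR n), rotZLIE_apply]
  exact corkscrewProfile_of_nearIdentity_rdss C₀ c θ u hc1 hclim hmild hmeas (fun n => hRθ n ▸ hrdss n) hTI hnz

/-! ### Contrapositive: near-identity removal for ALL rotated DSS about `e₃` -/

/-- **If there is no RSS profile, Chae–Wolf's near-identity removal holds for all rotated DSS about `e₃`.** For every
`C₀` there is `c₁ > 1` such that every Type-I (`C₀`) ancient mild solution which is rotated `c`-DSS about `e₃` through a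
coordinate-pinned rotation with `1 < c < c₁` vanishes (a.e. on every negative slice). -/
theorem nearIdentity_rdss_removal_of_not_rssProfileExists
    (h : ¬ Summit.NavierStokesRegularity.NavierStokesRegularity.Theses.FilamentSkeletonRss.RssProfileExists)
    (C₀ : ℝ) : ∃ c₁ : ℝ, 1 < c₁ ∧
      ∀ (c θ : ℝ) (R : EuclideanSpace ℝ (Fin 3) ≃ₗᵢ[ℝ] EuclideanSpace ℝ (Fin 3))
        (u : ℝ → EuclideanSpace ℝ (Fin 3) → EuclideanSpace ℝ (Fin 3)), 1 < c → c < c₁ →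
        (∀ x : EuclideanSpace ℝ (Fin 3), R x 0 = Real.cos θ * x 0 - Real.sin θ * x 1 ∧
          R x 1 = Real.sin θ * x 0 + Real.cos θ * x 1 ∧ R x 2 = x 2) →
        IsAncientMildSolution 1 u → (∀ t < 0, AEStronglyMeasurable (u t) volume) → IsRotatedDSS c R u →
        HasTypeIDecay C₀ u → ∀ t < 0, u t =ᵐ[volume] 0 := by
  by_contra H
  push Not at H
  have hpos : ∀ n : ℕ, (1 : ℝ) < 1 + 1 / ((n : ℝ) + 1) := fun n => by
    have : (0 : ℝ) < 1 / ((n : ℝ) + 1) := by positivity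
    linarith
  choose c θ R u hc1 hc2 hR hmild hmeas hrdss hTI t₀ ht₀ hne using fun n : ℕ => H (1 + 1 / ((n : ℝ) + 1)) (hpos n)
  have hclim : Tendsto c atTop (𝓝 1) := by
    have h0 : Tendsto (fun n : ℕ => (1 : ℝ) + 1 / ((n : ℝ) + 1)) atTop (𝓝 (1 + 0)) :=
      tendsto_const_nhds.add tendsto_one_div_add_atTop_nhds_zero_nat
    rw [add_zero] at h0
    exact tendsto_of_tendsto_of_tendsto_of_le_of_le tendsto_const_nhds h0 (fun n => (hc1 n).le)
      (fun n => (hc2 n).le)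
  have hRθ : ∀ n, R n = rotZLIE (θ n) := fun n =>
    LinearIsometryEquiv.ext fun x => by rw [eq_rotZ_of_pinned (hR n), rotZLIE_apply]
  exact h (rssProfileExists_of_nearIdentity_rdss C₀ c θ u hc1 hclim hmild hmeas (fun n => hRθ n ▸ hrdss n) hTI
    fun n hall => hne n (hall (t₀ n) (ht₀ n)))

/-- **If there is no corkscrew, Chae–Wolf's near-identity removal holds for all rotated DSS about `e₃`** (the crux's
sufficient condition in contrapositive: an RSS profile is a corkscrew, `corkscrewProfile_of_rssProfileExists`). -/
theorem nearIdentity_rdss_removal_of_not_corkscrewProfile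
    (h : ¬ Summit.NavierStokesRegularity.NavierStokesRegularity.Theses.CorkscrewDynamo.CorkscrewProfile)
    (C₀ : ℝ) : ∃ c₁ : ℝ, 1 < c₁ ∧
      ∀ (c θ : ℝ) (R : EuclideanSpace ℝ (Fin 3) ≃ₗᵢ[ℝ] EuclideanSpace ℝ (Fin 3))
        (u : ℝ → EuclideanSpace ℝ (Fin 3) → EuclideanSpace ℝ (Fin 3)), 1 < c → c < c₁ →
        (∀ x : EuclideanSpace ℝ (Fin 3), R x 0 = Real.cos θ * x 0 - Real.sin θ * x 1 ∧
          R x 1 = Real.sin θ * x 0 + Real.cos θ * x 1 ∧ R x 2 = x 2) →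
        IsAncientMildSolution 1 u → (∀ t < 0, AEStronglyMeasurable (u t) volume) → IsRotatedDSS c R u →
        HasTypeIDecay C₀ u → ∀ t < 0, u t =ᵐ[volume] 0 :=
  nearIdentity_rdss_removal_of_not_rssProfileExists (fun hR => h (corkscrewProfile_of_rssProfileExists hR)) C₀

/-! ### Unconditional: commensurable angles -/

/-- **Removal at commensurable angles (unconditional).** For every `C₀` there is `c₁ > 1` such that a Type-I (`C₀`)
ancient mild solution which is rotated `c`-DSS about `e₃` through a coordinate-pinned rotation by a COMMENSURABLE angle
`θ` (`qθ = 2πm`, `q ≥ 1`) with `c^q < c₁` vanishes: its sharp representative is plainly `c^q`-DSS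
(`IsRotatedDSS.rotZ_iterate_sub_two_pi_mul`, `rotZLIE 0 = 1`), classical for a global pressure, and Chae–Wolf 2017
Thm 1.3 (`chaeWolf2017_removing_dss_holds`) applies. [cite: ChaeWolf2017RemovingDSS, Thm 1.3 (arXiv:1610.09464 p. 3)] -/
theorem rdss_removal_commensurable (C₀ : ℝ) : ∃ c₁ : ℝ, 1 < c₁ ∧
    ∀ (c θ : ℝ) (q : ℕ) (m : ℤ) (R : EuclideanSpace ℝ (Fin 3) ≃ₗᵢ[ℝ] EuclideanSpace ℝ (Fin 3))
      (u : ℝ → EuclideanSpace ℝ (Fin 3) → EuclideanSpace ℝ (Fin 3)), 0 < q → (q : ℝ) * θ = 2 * Real.pi * m →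
      1 < c → c ^ q < c₁ →
      (∀ x : EuclideanSpace ℝ (Fin 3), R x 0 = Real.cos θ * x 0 - Real.sin θ * x 1 ∧
        R x 1 = Real.sin θ * x 0 + Real.cos θ * x 1 ∧ R x 2 = x 2) →
      IsAncientMildSolution 1 u → (∀ t < 0, AEStronglyMeasurable (u t) volume) → IsRotatedDSS c R u →
      HasTypeIDecay C₀ u → ∀ t < 0, u t =ᵐ[volume] 0 := by
  by_cases hC₀ : 0 < C₀
  · obtain ⟨c₁, hc₁, hCW⟩ := chaeWolf2017_removing_dss_holds C₀ hC₀
    refine ⟨c₁, hc₁, fun c θ q m R u hq hqθ hc hcq hR hmild hmeas hrdss hTI t ht => ?_⟩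
    have hc0 : 0 < c := one_pos.trans hc
    have hRθ : R = rotZLIE θ := LinearIsometryEquiv.ext fun x => by rw [eq_rotZ_of_pinned hR, rotZLIE_apply]
    obtain ⟨V, hV, hVdss, hVdec, hVu, -⟩ := stub_sharpRepresentative c R u C₀ hc0 hmild hmeas hrdss hTI
    rw [hRθ] at hVdss
    -- the representative is plainly `c^q`-DSS
    have hdss : IsDiscretelySelfSimilar (c ^ q) V := by
      have h := IsRotatedDSS.rotZ_iterate_sub_two_pi_mul hVdss q m
      rw [hqθ, sub_self, rotZLIE_zero] at h
      exact isRotatedDSS_refl_iff.1 h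
    obtain ⟨p, hp⟩ :=
      Summit.NavierStokesRegularity.NavierStokesRegularity.Theorems.SymmetricScarExists.LogtimeBernoulli.exists_isClassicalNSSolutionOn_Iio_of_isTypeIAncientMild
        hV
    have hq1 : 1 < c ^ q := one_lt_pow₀ hc (Nat.pos_iff_ne_zero.1 hq)
    have hVt : V t = 0 := funext fun x => hCW (c ^ q) hq1 hcq V p hp hdss hVdec t ht x
    rw [← hVt]
    exact (hVu t ht).symm
  · -- `C₀ ≤ 0`: the Type-I bound already forces `u = 0` on the past
    refine ⟨2, one_lt_two, fun c θ q m R u _ _ _ _ _ _ _ _ hTI t ht => Filter.EventuallyEq.of_eq (funext fun x => ?_)⟩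
    have h := hTI t ht x
    have hden : 0 < ‖x‖ + Real.sqrt (-t) := add_pos_of_nonneg_of_pos (norm_nonneg _) (Real.sqrt_pos.2 (by linarith))
    have h0 : C₀ / (‖x‖ + Real.sqrt (-t)) ≤ 0 := div_nonpos_of_nonpos_of_nonneg (not_lt.1 hC₀) hden.le
    exact norm_le_zero_iff.1 (h.trans h0)

/-- **The literal statement of `QuarterTurnRdss.NearIdentityRemoval` (stmt-NavierStokesRegularity-1102)**: for each
Type-I constant, quarter-turn rotated-DSS ancient mild solutions with factor `c` close to `1` vanish (a quarter turn is
the coordinate-pinned rotation by `θ = π/2`, commensurable with `q = 4`; `c < c₁^{1/4}` gives `c⁴ < c₁`). -/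
theorem quarterTurn_nearIdentityRemoval :
    ∀ C₀ : ℝ, ∃ c₁ : ℝ, 1 < c₁ ∧ ∀ c : ℝ, 1 < c → c < c₁ →
      ∀ R : EuclideanSpace ℝ (Fin 3) ≃ₗᵢ[ℝ] EuclideanSpace ℝ (Fin 3),
        (∀ x : EuclideanSpace ℝ (Fin 3), (R x) 0 = -(x 1) ∧ (R x) 1 = x 0 ∧ (R x) 2 = x 2) →
        ∀ u : ℝ → EuclideanSpace ℝ (Fin 3) → EuclideanSpace ℝ (Fin 3), IsAncientMildSolution 1 u →
          (∀ t < 0, AEStronglyMeasurable (u t) volume) → IsRotatedDSS c R u → HasTypeIDecay C₀ u →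
          ∀ t < 0, u t =ᵐ[volume] 0 := by
  intro C₀
  obtain ⟨c₁, hc₁, h⟩ := rdss_removal_commensurable C₀
  have hc₁0 : 0 < c₁ := one_pos.trans hc₁
  refine ⟨c₁ ^ (1 / 4 : ℝ), Real.one_lt_rpow hc₁ (by norm_num), fun c hc hcc R hR u hmild hmeas hrdss hTI => ?_⟩
  have hc0 : 0 ≤ c := (one_pos.trans hc).le
  have hc4 : c ^ 4 < c₁ := by
    have h1 : c ^ 4 < (c₁ ^ (1 / 4 : ℝ)) ^ 4 := pow_lt_pow_left₀ hcc hc0 (by norm_num)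
    have h2 : (c₁ ^ (1 / 4 : ℝ)) ^ 4 = c₁ := by
      rw [← Real.rpow_natCast, ← Real.rpow_mul hc₁0.le]
      norm_num
    rwa [h2] at h1
  refine h c (Real.pi / 2) 4 1 R u (by norm_num) ?_ hc hc4 (fun x => ?_) hmild hmeas hrdss hTI
  · push_cast; ring
  · obtain ⟨h0, h1, h2⟩ := hR x
    simp only [Real.cos_pi_div_two, Real.sin_pi_div_two, zero_mul, one_mul, zero_sub, add_zero]
    exact ⟨h0, h1, h2⟩

/-! ### The registered signature -/

/-- **Registered tool stub F5 `stub_nearIdentityRigidity`** — (i) near-identity nontrivial Type-I rotated-DSS ancient mild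
solutions about `e₃` at a bounded constant force `RssProfileExists` (hence the crux); (ii) if there is no corkscrew,
Chae–Wolf's near-identity removal holds for all rotated DSS about `e₃`. -/
theorem stub_nearIdentityRigidity :
    (∀ (C₀ : ℝ) (c θ : ℕ → ℝ) (u : ℕ → ℝ → EuclideanSpace ℝ (Fin 3) → EuclideanSpace ℝ (Fin 3)),
      (∀ n, 1 < c n) → Filter.Tendsto c Filter.atTop (nhds 1) →
      (∀ n, Literature.Analysis.FluidPDE.IsAncientMildSolution 1 (u n)) →
      (∀ n, ∀ t < 0, MeasureTheory.AEStronglyMeasurable (u n t) MeasureTheory.volume) →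
      (∀ n, Literature.Analysis.FluidPDE.IsRotatedDSS (c n) (Literature.Analysis.FluidPDE.rotZLIE (θ n)) (u n)) →
      (∀ n, Literature.Analysis.FluidPDE.HasTypeIDecay C₀ (u n)) →
      (∀ n, ¬ ∀ t < 0, u n t =ᵐ[MeasureTheory.volume] 0) →
      Summit.NavierStokesRegularity.NavierStokesRegularity.Theses.FilamentSkeletonRss.RssProfileExists) ∧
    (¬ Summit.NavierStokesRegularity.NavierStokesRegularity.Theses.CorkscrewDynamo.CorkscrewProfile →
      ∀ C₀ : ℝ, ∃ c₁ : ℝ, 1 < c₁ ∧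
        ∀ (c θ : ℝ) (R : EuclideanSpace ℝ (Fin 3) ≃ₗᵢ[ℝ] EuclideanSpace ℝ (Fin 3))
          (u : ℝ → EuclideanSpace ℝ (Fin 3) → EuclideanSpace ℝ (Fin 3)), 1 < c → c < c₁ →
          (∀ x : EuclideanSpace ℝ (Fin 3), R x 0 = Real.cos θ * x 0 - Real.sin θ * x 1 ∧
            R x 1 = Real.sin θ * x 0 + Real.cos θ * x 1 ∧ R x 2 = x 2) →
          Literature.Analysis.FluidPDE.IsAncientMildSolution 1 u →
          (∀ t < 0, MeasureTheory.AEStronglyMeasurable (u t) MeasureTheory.volume) →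
          Literature.Analysis.FluidPDE.IsRotatedDSS c R u → Literature.Analysis.FluidPDE.HasTypeIDecay C₀ u →
          ∀ t < 0, u t =ᵐ[MeasureTheory.volume] 0) :=
  ⟨rssProfileExists_of_nearIdentity_rdss, nearIdentity_rdss_removal_of_not_corkscrewProfile⟩

end Summit.NavierStokesRegularity.NavierStokesRegularity.Theorems.CorkscrewProfile.Birth

end
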